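/-
Copyright (c) 2026 the pub-hodgecm-mathlib formalisation cell (harness21).  Prover seat hodgecm-mathlib-K2E3-p21 (g6), Track B «K2-LIT» ∕ h413
(`stmt-HodgeConjecture-24833`), line `K2_E3_EllipticInputs`, line «SC′-IRR-lev» (lead-designate K2E3-p24 (g0), CENSUS-SCprimeIRR.v1 §(ii) brick T1;
dealer K2E3-plan (g4) D81), leaf (S-C′-irr) `sig_K2E3GL3TwoBlockInducedIrreducible`.  2026-09-04.
-/
import Literature.NumberTheory.Automorphic.ParabolicGLReindex                 -- ★ `IsSmooth.comp_of_continuous`, the reindex-transport template; brings ★ `SmoothIndTransport`, `ParabolicGL`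
import Literature.NumberTheory.Automorphic.ParabolicInduction                 -- ★ instance `LocallyCompactSpace ↥P_c`
import Literature.NumberTheory.Automorphic.GLnGelfandKazhdanInvolution        -- ★ `gkAutomorphism : GL_n ≃ₜ* GL_n` (`g ↦ w⁰ ᵗg⁻¹ w⁰`), `coe_gkInvolution_apply`
import Literature.NumberTheory.Rogawski1990.SupercuspidalNotSphericalCofinite  -- ★ `Representation.IsSupercuspidal.comp_continuousMulEquiv`
import HarnessLib

/-!
# Crux `H413` — K2-LIT E3, line «SC′-IRR-lev», brick T1: the OUTER AUTOMORPHISM `θ(g) = w₀ ᵗg⁻¹ w₀` of `GL₃(F)` exchanges the two maximal parabolics, and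
# parabolic induction from `P_{(1,2)}` is irreducible as soon as it is from `P_{(2,1)}` (and conversely)

Cell `hodgecm-mathlib`, Track B, line `K2_E3_EllipticInputs`; leaf (S-C′-irr) `sig_K2E3GL3TwoBlockInducedIrreducible` (U12 :491: `i_Q σ` irreducible for `σ` an
irreducible supercuspidal representation of a maximal Levi of `GL₃(F)`, BOTH block labellings `c ∈ {![0,0,1], ![0,1,1]}`); line «SC′-IRR-lev» (K2E3-p24 (g0),
`CENSUS-SCprimeIRR.v1.K2E3-p24-g0.md`): the ASM proves the labelling `![0,0,1]` (`Q = P_{(2,1)}`) and gets `![0,1,1]` «by T1».  THEOREMS ONLY; count-neutral helper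
(`--supports stmt-HodgeConjecture-24833 --as helper`); no `def` ∕ `instance` ∕ `notation` (the automorphism is ★ `gkAutomorphism`, the Levi isomorphism is built inside
the proofs).

* §1 GENERIC TRANSPORT along a continuous automorphism `θ` of `GL_n(F)` with `θ(P_c) = P_{c'}` (★ `SmoothInd.transportEquiv`, ★ `rootDeltaChar_transport`):
  `leviProjection_apply_eq_of_ker` («if `θ(U_c) ⊆ U_{c'}` then `proj_{c'}(θ p)` only depends on `proj_c p`», the ★ `leviProjection_parabolicReindex` pattern) and
  **`isIrreducible_parabolicIndGL_iff_of_continuousMulEquiv`**: for `σ`, `σ'` on the two Levi factors with `σ' ∘ proj_{c'} ∘ θ = σ ∘ proj_c` on `P_c`,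
  `i_c σ` is irreducible iff `i_{c'} σ'` is (`f ↦ f ∘ θ⁻¹` is a `θ`-equivariant isomorphism, `δ_{c'}^{1/2} ∘ θ = δ_c^{1/2}`).
* §2 **`isIrreducible_parabolicIndGL_of_involution`**: for an involutive such `θ` with `θ(U_c) ⊆ U_{c'}`, `θ(U_{c'}) ⊆ U_c`, the Levi factors are isomorphic as topological
  groups (`m ↦ proj_c (θ (diag m))`, inverse the same formula), so «every supercuspidally induced `i_{c'} σ'` is irreducible» implies the same for `i_c`
  (★ `isIrreducible_comp_of_surjective`, ★ `IsSmooth.comp_of_continuous`, ★ `IsSupercuspidal.comp_continuousMulEquiv`).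
* §3 THE CONCRETE `θ = gkAutomorphism` ON `GL₃(F)` (`(θ g)_{ij} = (g⁻¹)_{2−j,2−i}`): `θ(P_{![0,1,1]}) = P_{![0,0,1]}`, `θ(U_{![0,1,1]}) = U_{![0,0,1]}` and vice versa
  (entrywise; generic entry lemmas `apply_eq_of_mem_unipotentRadicalGL` ∕ `mem_unipotentRadicalGL_of_apply`), and the HEADS
  **`isIrreducible_parabolicIndGL_one_two_of_two_one`** ∕ **`…_two_one_of_one_two`** (data-free: «all supercuspidally induced `i_{![0,0,1]}` irreducible ⟹ all
  `i_{![0,1,1]}` irreducible» and conversely, same coefficient space `W`).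

HONEST LABEL: HC_CM is proved only modulo the 7 printed citations (2 remaining named inputs: hLiu418 = stmt-HodgeConjecture-24832, h413 =
stmt-HodgeConjecture-24833) until rung 0 closes; elementary, closes no organ by itself (the ASM of «SC′-IRR-lev» consumes §3).

## References
* [BernsteinZelevinskyASENS1977] I. N. Bernstein, A. V. Zelevinsky, *Induced representations of reductive p-adic groups I*, Ann. Sci. ÉNS 10 (1977), §2.1–2.3
  (standard parabolics, `i_{G,M}`), and 1976 §2.21–2.25 (induction commutes with isomorphisms).
* [Bump1997] D. Bump, *Automorphic Forms and Representations* (1997), §4.4 p. 455 (the involution `g ↦ w⁰ ᵗg⁻¹ w⁰`).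
* [Zelevinsky1980] A. V. Zelevinsky, *Induced representations of reductive p-adic groups II*, Ann. Sci. ÉNS 13 (1980), §1.1, Thm. 4.2.
-/

set_option autoImplicit false
-- the mandated namespace repeats `HodgeConjecture.HodgeConjecture`, as in every `Theorems/*.lean` of this sub-problem
set_option linter.dupNamespace false

noncomputable section

open Literature.NumberTheory.Automorphic Representation

namespace Summit.HodgeConjecture.HodgeConjecture.Cruxes.H413.K2E3GL3OuterAutomorphismInduction

/-! ## §1  Generic transport along a continuous automorphism exchanging two standard parabolics -/

section Generic

variable (F : Type*) [Field F] [ValuativeRel F] [TopologicalSpace F] [IsNonarchimedeanLocalField F]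
  {n : Type*} [Fintype n] [DecidableEq n] {α β : Type*} [LinearOrder α] [Fintype α] [LinearOrder β] [Fintype β]
  (c : n → α) (c' : n → β)

omit [ValuativeRel F] [TopologicalSpace F] [IsNonarchimedeanLocalField F] [Fintype β] in
/-- **`proj_{c'} (θ p)` only depends on `proj_c p`** when the automorphism `θ` maps `P_c` onto `P_{c'}` and `U_c` into `U_{c'}`: `p = diag(proj_c p) · u` with `u ∈ U_c`
(the ★ `leviProjection_parabolicReindex` pattern). [cite: BernsteinZelevinskyASENS1977, §2.1] -/
theorem leviProjection_apply_eq_of_ker (θ : GL n F ≃* GL n F)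
    (hP : ∀ x, θ x ∈ standardParabolicGL F c' ↔ x ∈ standardParabolicGL F c)
    (hU : ∀ p : ↥(standardParabolicGL F c), p ∈ unipotentRadicalP F c →
      (⟨θ p, (hP p).2 p.2⟩ : ↥(standardParabolicGL F c')) ∈ unipotentRadicalP F c')
    (p : ↥(standardParabolicGL F c)) :
    leviProjection F c' ⟨θ p, (hP p).2 p.2⟩ =
      leviProjection F c' ⟨θ (leviEmbeddingP F c (leviProjection F c p) : ↥(standardParabolicGL F c)),
        (hP _).2 (leviEmbeddingP F c (leviProjection F c p)).2⟩ := by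
  let θP : ↥(standardParabolicGL F c) →* ↥(standardParabolicGL F c') :=
    (θ.toMonoidHom.comp (standardParabolicGL F c).subtype).codRestrict _ fun q => (hP q).2 q.2
  set m := leviEmbeddingP F c (leviProjection F c p) with hm
  have hu : m⁻¹ * p ∈ unipotentRadicalP F c := by
    rw [MonoidHom.mem_ker, map_mul, map_inv, hm, leviProjection_leviEmbeddingP_apply, inv_mul_cancel]
  have hker : leviProjection F c' (θP (m⁻¹ * p)) = 1 := (MonoidHom.mem_ker).1 (hU _ hu)
  change leviProjection F c' (θP p) = leviProjection F c' (θP m)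
  calc leviProjection F c' (θP p) = leviProjection F c' (θP (m * (m⁻¹ * p))) := by rw [mul_inv_cancel_left]
    _ = leviProjection F c' (θP m) := by rw [map_mul, map_mul, hker, mul_one]

omit [Fintype α] [Fintype β] in
/-- **TRANSPORT OF `i_c σ` ALONG `θ`.**  `θ` a continuous automorphism of `GL_n(F)` with `θ(P_c) = P_{c'}`, `σ`, `σ'` representations of the two Levi factors on the
same space with `σ'(proj_{c'}(θ p)) = σ(proj_c p)` for `p ∈ P_c`.  Then `δ_{P_{c'}}^{1/2} ∘ θ = δ_{P_c}^{1/2}` (★ `rootDeltaChar_transport`) and `f ↦ f ∘ θ⁻¹` is a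
`θ`-equivariant linear isomorphism `i_c σ ≃ i_{c'} σ'` (★ `SmoothInd.transportEquiv`), so one is irreducible iff the other is.
[cite: BernsteinZelevinskyASENS1977, §2.3] -/
theorem isIrreducible_parabolicIndGL_iff_of_continuousMulEquiv
    [LocallyCompactSpace ↥(standardParabolicGL F c)] [LocallyCompactSpace ↥(standardParabolicGL F c')]
    (θ : GL n F ≃ₜ* GL n F) (hP : ∀ x, θ x ∈ standardParabolicGL F c' ↔ x ∈ standardParabolicGL F c)
    {W : Type*} [AddCommGroup W] [Module ℂ W]
    (σ : Representation ℂ (Π a, GL {i // c i = a} F) W) (σ' : Representation ℂ (Π b, GL {i // c' i = b} F) W)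
    (hσ : ∀ p : ↥(standardParabolicGL F c), σ' (leviProjection F c' ⟨θ p, (hP p).2 p.2⟩) = σ (leviProjection F c p)) :
    (parabolicIndGL F c σ).IsIrreducible ↔ (parabolicIndGL F c' σ').IsIrreducible := by
  have hφ : Continuous (θ : GL n F ≃* GL n F) := θ.continuous
  have hφ' : Continuous (θ : GL n F ≃* GL n F).symm := θ.symm.continuous
  have hP₁ : ∀ x, (θ : GL n F ≃* GL n F) x ∈ standardParabolicGL F c' ↔ x ∈ standardParabolicGL F c := hP
  have hσ₁ : ∀ p : ↥(standardParabolicGL F c),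
      σ' (leviProjection F c' ⟨(θ : GL n F ≃* GL n F) p, (hP₁ p).2 p.2⟩) = σ (leviProjection F c p) := fun p => hσ p
  have hτ : ∀ x : ↥(standardParabolicGL F c),
      Representation.twist (σ.comp (leviProjection F c)) (rootDeltaChar (standardParabolicGL F c)) x =
        Representation.twist (σ'.comp (leviProjection F c')) (rootDeltaChar (standardParabolicGL F c'))
          ⟨(θ : GL n F ≃* GL n F) x, (hP₁ x).2 x.2⟩ := by
    intro x
    refine LinearMap.ext fun v => ?_
    change ((rootDeltaChar (standardParabolicGL F c) x : ℂˣ) : ℂ) • σ (leviProjection F c x) v =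
      ((rootDeltaChar (standardParabolicGL F c') ⟨(θ : GL n F ≃* GL n F) x, (hP₁ x).2 x.2⟩ : ℂˣ) : ℂ) •
        σ' (leviProjection F c' ⟨(θ : GL n F ≃* GL n F) x, (hP₁ x).2 x.2⟩) v
    rw [rootDeltaChar_transport (θ : GL n F ≃* GL n F) hφ hφ' hP₁ x, hσ₁ x]
  have hequiv := SmoothInd.transportEquiv_smoothIndRep (θ : GL n F ≃* GL n F) hφ hφ' hP₁ hτ
  constructor
  · intro h
    haveI : (parabolicIndGL F c σ).IsIrreducible := h
    exact isIrreducible_of_equivariant_equiv (ρ' := parabolicIndGL F c σ) (ρ := parabolicIndGL F c' σ') (θ : GL n F ≃* GL n F)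
      (SmoothInd.transportEquiv (θ : GL n F ≃* GL n F) hφ hφ' hP₁ hτ) hequiv
  · intro h
    haveI : (parabolicIndGL F c' σ').IsIrreducible := h
    exact isIrreducible_of_equivariant_equiv (ρ' := parabolicIndGL F c' σ') (ρ := parabolicIndGL F c σ) (θ : GL n F ≃* GL n F).symm
      (SmoothInd.transportEquiv (θ : GL n F ≃* GL n F) hφ hφ' hP₁ hτ).symm
      (symm_apply_of_equivariant (θ : GL n F ≃* GL n F) (SmoothInd.transportEquiv (θ : GL n F ≃* GL n F) hφ hφ' hP₁ hτ) hequiv)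

omit [Fintype α] in
/-- Continuity of the Levi projection (copy of the private ★ `continuous_leviProjection₅` of `ParabolicGLReindex`). [folklore] -/
theorem continuous_leviProjection_gl : Continuous (leviProjection F c) := by
  haveI : IsTopologicalRing F := inferInstance
  refine continuous_pi fun a => Units.continuous_iff.2 ⟨?_, ?_⟩
  · exact continuous_matrix fun i j =>
      (Units.continuous_val.comp continuous_subtype_val).matrix_elem (i : n) (j : n)
  · exact continuous_matrix fun i j =>
      ((Units.continuous_val.comp continuous_subtype_val).comp continuous_inv).matrix_elem (i : n) (j : n)

/-- Continuity of the block diagonal embedding into `P_c` (copy of the private ★ `continuous_leviEmbeddingP₅` of `ParabolicGLReindex`). [folklore] -/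
theorem continuous_leviEmbeddingP_gl : Continuous (leviEmbeddingP F c) := by
  haveI : IsTopologicalRing F := inferInstance
  have hval : Continuous fun x : (Π a, GL {i // c i = a} F) => ((blockDiagonalGL F c x : GL n F) : Matrix n n F) := by
    have h : Continuous fun x : (Π a, GL {i // c i = a} F) => fun a =>
        ((x a : GL {i // c i = a} F) : Matrix {i // c i = a} {i // c i = a} F) :=
      continuous_pi fun a => Units.continuous_val.comp (continuous_apply a)
    refine continuous_matrix fun i j => ?_
    simp_rw [blockDiagonalGL_apply_coe]
    exact h.matrix_blockDiagonal'.matrix_elem _ _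
  have hbd : Continuous (blockDiagonalGL F c) := by
    refine Units.continuous_iff.2 ⟨hval, ?_⟩
    have : (fun x : (Π a, GL {i // c i = a} F) => (((blockDiagonalGL F c x)⁻¹ : GL n F) : Matrix n n F)) =
        fun x => ((blockDiagonalGL F c x⁻¹ : GL n F) : Matrix n n F) := by
      funext x; rw [map_inv]
    rw [this]
    exact hval.comp continuous_inv
  exact hbd.subtype_mk _

/-! ## §2  An involution exchanging `(P_c, U_c)` and `(P_{c'}, U_{c'})` identifies the Levi factors and transports irreducibility of supercuspidal inductions -/

/-- **IRREDUCIBILITY OF SUPERCUSPIDALLY INDUCED `i_c` FROM `i_{c'}` ALONG AN INVOLUTION.**  `θ` a continuous involutive automorphism of `GL_n(F)` with `θ(P_c) = P_{c'}`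
(hence `θ(P_{c'}) = P_c`), `θ(U_c) ⊆ U_{c'}` and `θ(U_{c'}) ⊆ U_c`.  Then `m ↦ proj_c(θ(diag m))` is an isomorphism of topological groups `M_{c'} ≃ M_c` (inverse
`m ↦ proj_{c'}(θ(diag m))`), `σ ∘ (M_{c'} ≃ M_c)` is irreducible ∕ smooth ∕ supercuspidal with `σ`, and §1 applies: if EVERY `i_{c'} σ'` with `σ'` irreducible smooth
supercuspidal on `W` is irreducible, then so is `i_c σ` for every such `σ` on `W`. [cite: BernsteinZelevinskyASENS1977, §2.3] [cite: Zelevinsky1980, §1.1] -/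
theorem isIrreducible_parabolicIndGL_of_involution
    [LocallyCompactSpace ↥(standardParabolicGL F c)] [LocallyCompactSpace ↥(standardParabolicGL F c')]
    (θ : GL n F ≃ₜ* GL n F) (hθθ : ∀ g, θ (θ g) = g)
    (hP : ∀ x, θ x ∈ standardParabolicGL F c' ↔ x ∈ standardParabolicGL F c)
    (hP' : ∀ x, θ x ∈ standardParabolicGL F c ↔ x ∈ standardParabolicGL F c')
    (hU : ∀ p : ↥(standardParabolicGL F c), p ∈ unipotentRadicalP F c →
      (⟨θ p, (hP p).2 p.2⟩ : ↥(standardParabolicGL F c')) ∈ unipotentRadicalP F c')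
    (hU' : ∀ p : ↥(standardParabolicGL F c'), p ∈ unipotentRadicalP F c' →
      (⟨θ p, (hP' p).2 p.2⟩ : ↥(standardParabolicGL F c)) ∈ unipotentRadicalP F c)
    {W : Type*} [AddCommGroup W] [Module ℂ W]
    (h' : ∀ σ' : Representation ℂ (Π b, GL {i // c' i = b} F) W,
      σ'.IsIrreducible → σ'.IsSmooth → σ'.IsSupercuspidal → (parabolicIndGL F c' σ').IsIrreducible)
    (σ : Representation ℂ (Π a, GL {i // c i = a} F) W) [σ.IsIrreducible] (hσ : σ.IsSmooth) (hsc : σ.IsSupercuspidal) :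
    (parabolicIndGL F c σ).IsIrreducible := by
  -- the restrictions of `θ` to the parabolics
  let θP : ↥(standardParabolicGL F c) →* ↥(standardParabolicGL F c') :=
    ((θ : GL n F ≃* GL n F).toMonoidHom.comp (standardParabolicGL F c).subtype).codRestrict _ fun q => (hP q).2 q.2
  let θP' : ↥(standardParabolicGL F c') →* ↥(standardParabolicGL F c) :=
    ((θ : GL n F ≃* GL n F).toMonoidHom.comp (standardParabolicGL F c').subtype).codRestrict _ fun q => (hP' q).2 q.2
  have hθP : ∀ q, ((θP q : ↥(standardParabolicGL F c')) : GL n F) = θ q := fun q => rfl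
  have hθP' : ∀ q, ((θP' q : ↥(standardParabolicGL F c)) : GL n F) = θ q := fun q => rfl
  have hθc : Continuous θP := (θ.continuous.comp continuous_subtype_val).subtype_mk _
  have hθc' : Continuous θP' := (θ.continuous.comp continuous_subtype_val).subtype_mk _
  -- the Levi isomorphism `e : M_{c'} ≃ₜ* M_c` and its inverse `g`
  let f : (Π b, GL {i // c' i = b} F) →* (Π a, GL {i // c i = a} F) := ((leviProjection F c).comp θP').comp (leviEmbeddingP F c')
  let g : (Π a, GL {i // c i = a} F) →* (Π b, GL {i // c' i = b} F) := ((leviProjection F c').comp θP).comp (leviEmbeddingP F c)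
  -- `proj_c (θ (diag (proj_{c'} (θ q)))) = proj_c q` for `q ∈ P_c` (and symmetrically)
  have key : ∀ q : ↥(standardParabolicGL F c), f (leviProjection F c' (θP q)) = leviProjection F c q := by
    intro q
    have h1 := leviProjection_apply_eq_of_ker F c' c (θ : GL n F ≃* GL n F) hP' hU' (θP q)
    have h2 : (⟨(θ : GL n F ≃* GL n F) ((θP q : ↥(standardParabolicGL F c')) : GL n F), (hP' _).2 (θP q).2⟩ : ↥(standardParabolicGL F c)) = q :=
      Subtype.ext (hθθ _)
    rw [h2] at h1
    exact h1.symm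
  have key' : ∀ q : ↥(standardParabolicGL F c'), g (leviProjection F c (θP' q)) = leviProjection F c' q := by
    intro q
    have h1 := leviProjection_apply_eq_of_ker F c c' (θ : GL n F ≃* GL n F) hP hU (θP' q)
    have h2 : (⟨(θ : GL n F ≃* GL n F) ((θP' q : ↥(standardParabolicGL F c)) : GL n F), (hP _).2 (θP' q).2⟩ : ↥(standardParabolicGL F c')) = q :=
      Subtype.ext (hθθ _)
    rw [h2] at h1
    exact h1.symm
  have hfg : ∀ m, f (g m) = m := fun m => by
    change f (leviProjection F c' (θP (leviEmbeddingP F c m))) = m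
    rw [key, leviProjection_leviEmbeddingP_apply]
  have hgf : ∀ m, g (f m) = m := fun m => by
    change g (leviProjection F c (θP' (leviEmbeddingP F c' m))) = m
    rw [key', leviProjection_leviEmbeddingP_apply]
  have hfc : Continuous f :=
    ((continuous_leviProjection_gl F c).comp hθc').comp (continuous_leviEmbeddingP_gl F c')
  have hgc : Continuous g :=
    ((continuous_leviProjection_gl F c').comp hθc).comp (continuous_leviEmbeddingP_gl F c)
  let e : (Π b, GL {i // c' i = b} F) ≃ₜ* (Π a, GL {i // c i = a} F) :=
    { toFun := f, invFun := g, left_inv := hgf, right_inv := hfg, map_mul' := f.map_mul,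
      continuous_toFun := hfc, continuous_invFun := hgc }
  have he : ∀ m, e m = f m := fun _ => rfl
  -- `σ' := σ ∘ e` is irreducible, smooth, supercuspidal
  haveI hirr : Representation.IsIrreducible (σ.comp (e : (Π b, GL {i // c' i = b} F) →* (Π a, GL {i // c i = a} F))) :=
    isIrreducible_comp_of_surjective σ (e : (Π b, GL {i // c' i = b} F) →* (Π a, GL {i // c i = a} F)) e.surjective
  have hsm : Representation.IsSmooth (σ.comp (e : (Π b, GL {i // c' i = b} F) →* (Π a, GL {i // c i = a} F))) :=
    IsSmooth.comp_of_continuous σ (e : (Π b, GL {i // c' i = b} F) →* (Π a, GL {i // c i = a} F)) e.continuous hσ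
  have hsc' : Representation.IsSupercuspidal (σ.comp (e : (Π b, GL {i // c' i = b} F) →* (Π a, GL {i // c i = a} F))) :=
    hsc.comp_continuousMulEquiv e
  have hind := h' _ hirr hsm hsc'
  -- §1 with the compatibility `σ(e(proj_{c'}(θ p))) = σ(proj_c p)`
  have hcompat : ∀ p : ↥(standardParabolicGL F c),
      (σ.comp (e : (Π b, GL {i // c' i = b} F) →* (Π a, GL {i // c i = a} F)) : Representation ℂ (Π b, GL {i // c' i = b} F) W)
          (leviProjection F c' ⟨θ p, (hP p).2 p.2⟩) = σ (leviProjection F c p) := by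
    intro p
    change σ (e (leviProjection F c' (θP p))) = σ (leviProjection F c p)
    rw [he, key]
  exact (isIrreducible_parabolicIndGL_iff_of_continuousMulEquiv F c c' θ hP σ _ hcompat).2 hind

end Generic

/-! ## §3  The outer automorphism `θ(g) = w₀ ᵗg⁻¹ w₀` of `GL₃(F)` and the two maximal parabolics -/

section GL3

variable (F : Type*) [Field F] [ValuativeRel F] [TopologicalSpace F] [IsNonarchimedeanLocalField F]

section Entries

variable {F} {m : ℕ} {α : Type*} [LinearOrder α] (c : Fin m → α)

/-- Entries of `θ(g) = w₀ ᵗg⁻¹ w₀`: `(θ g)_{ij} = (g⁻¹)_{rev j, rev i}` (★ `gkAutomorphism_apply`, `coe_gkInvolution_apply`). [cite: Bump1997, §4.4 p. 455] -/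
theorem coe_gkAutomorphism_apply (g : GL (Fin m) F) (i j : Fin m) :
    ((gkAutomorphism g : GL (Fin m) F) : Matrix (Fin m) (Fin m) F) i j = ((g⁻¹ : GL (Fin m) F) : Matrix (Fin m) (Fin m) F) j.rev i.rev := by
  rw [gkAutomorphism_apply, coe_gkInvolution_apply]

omit [ValuativeRel F] [TopologicalSpace F] [IsNonarchimedeanLocalField F] in
/-- The diagonal-block entries of an element of `U_c` are those of the identity. [cite: BernsteinZelevinskyASENS1977, §2.1] -/
theorem apply_eq_of_mem_unipotentRadicalGL {g : GL (Fin m) F} (hg : g ∈ unipotentRadicalGL F c) (i j : Fin m) (hij : c i = c j) :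
    (g : Matrix (Fin m) (Fin m) F) i j = if i = j then 1 else 0 := by
  obtain ⟨-, h1⟩ := (mem_unipotentRadicalGL_iff c g).1 hg
  have h := congrFun (congrFun (h1 (c j)) ⟨i, hij⟩) ⟨j, rfl⟩
  rw [Matrix.toSquareBlock_def, Matrix.of_apply, Matrix.one_apply] at h
  rw [h]
  by_cases hij' : i = j
  · subst hij'; rw [if_pos rfl, if_pos rfl]
  · rw [if_neg hij', if_neg fun h' => hij' (congrArg Subtype.val h')]

omit [ValuativeRel F] [TopologicalSpace F] [IsNonarchimedeanLocalField F] in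
/-- Entrywise criterion for `U_c`: zero below the block diagonal, identity on the diagonal blocks. [cite: BernsteinZelevinskyASENS1977, §2.1] -/
theorem mem_unipotentRadicalGL_of_apply {g : GL (Fin m) F} (h0 : ∀ i j, c j < c i → (g : Matrix (Fin m) (Fin m) F) i j = 0)
    (h1 : ∀ i j, c i = c j → (g : Matrix (Fin m) (Fin m) F) i j = if i = j then 1 else 0) : g ∈ unipotentRadicalGL F c := by
  refine (mem_unipotentRadicalGL_iff c g).2 ⟨fun i j hij => h0 i j hij, fun a => ?_⟩
  ext ⟨i, hi⟩ ⟨j, hj⟩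
  rw [Matrix.toSquareBlock_def, Matrix.of_apply, h1 i j (hi.trans hj.symm), Matrix.one_apply]
  by_cases hij' : i = j
  · subst hij'; rw [if_pos rfl, if_pos rfl]
  · rw [if_neg hij', if_neg fun h' => hij' (congrArg Subtype.val h')]

end Entries

/-- `θ ∘ θ = id` for `θ(g) = w₀ ᵗg⁻¹ w₀` (`ι(ι g) = g`, `ι(g⁻¹) = ι(g)⁻¹` for the ★ Gelfand–Kazhdan involution `ι`). [cite: Bump1997, §4.4 p. 455] -/
theorem gkAutomorphism_gkAutomorphism {m : ℕ} (g : GL (Fin m) F) : gkAutomorphism (gkAutomorphism g) = g := by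
  rw [gkAutomorphism_apply, gkAutomorphism_apply, ← gkInvolution_inv, inv_inv, gkInvolution_gkInvolution]

/-- **`θ(P_{(1,2)}) = P_{(2,1)}`**: `θ x` is block upper triangular for `![0,0,1]` iff `x` is for `![0,1,1]` (entries of `θ x` are entries of `x⁻¹` reflected in the
antidiagonal, and `P` is closed under inversion). [cite: Zelevinsky1980, §1.1] -/
theorem gkAutomorphism_mem_parabolic_two_one_iff (x : GL (Fin 3) F) :
    gkAutomorphism x ∈ standardParabolicGL F (![0, 0, 1] : Fin 3 → Fin 2) ↔ x ∈ standardParabolicGL F (![0, 1, 1] : Fin 3 → Fin 2) := by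
  have hrel : ∀ i j : Fin 3, (![0, 1, 1] : Fin 3 → Fin 2) j < ![0, 1, 1] i → (![0, 0, 1] : Fin 3 → Fin 2) i.rev < ![0, 0, 1] j.rev := by decide
  have hrel' : ∀ i j : Fin 3, (![0, 0, 1] : Fin 3 → Fin 2) j < ![0, 0, 1] i → (![0, 1, 1] : Fin 3 → Fin 2) i.rev < ![0, 1, 1] j.rev := by decide
  rw [← (standardParabolicGL F (![0, 1, 1] : Fin 3 → Fin 2)).inv_mem_iff (x := x), mem_standardParabolicGL_iff, mem_standardParabolicGL_iff]
  constructor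
  · intro h i j hij
    have h' := h (hrel i j hij)
    rwa [coe_gkAutomorphism_apply, Fin.rev_rev, Fin.rev_rev] at h'
  · intro h i j hij
    rw [coe_gkAutomorphism_apply]
    exact h (hrel' i j hij)

/-- **`θ(P_{(2,1)}) = P_{(1,2)}`** (the same with the labellings exchanged). [cite: Zelevinsky1980, §1.1] -/
theorem gkAutomorphism_mem_parabolic_one_two_iff (x : GL (Fin 3) F) :
    gkAutomorphism x ∈ standardParabolicGL F (![0, 1, 1] : Fin 3 → Fin 2) ↔ x ∈ standardParabolicGL F (![0, 0, 1] : Fin 3 → Fin 2) := by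
  have hrel : ∀ i j : Fin 3, (![0, 0, 1] : Fin 3 → Fin 2) j < ![0, 0, 1] i → (![0, 1, 1] : Fin 3 → Fin 2) i.rev < ![0, 1, 1] j.rev := by decide
  have hrel' : ∀ i j : Fin 3, (![0, 1, 1] : Fin 3 → Fin 2) j < ![0, 1, 1] i → (![0, 0, 1] : Fin 3 → Fin 2) i.rev < ![0, 0, 1] j.rev := by decide
  rw [← (standardParabolicGL F (![0, 0, 1] : Fin 3 → Fin 2)).inv_mem_iff (x := x), mem_standardParabolicGL_iff, mem_standardParabolicGL_iff]
  constructor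
  · intro h i j hij
    have h' := h (hrel i j hij)
    rwa [coe_gkAutomorphism_apply, Fin.rev_rev, Fin.rev_rev] at h'
  · intro h i j hij
    rw [coe_gkAutomorphism_apply]
    exact h (hrel' i j hij)

/-- **`θ(U_{(1,2)}) ⊆ U_{(2,1)}`** (entrywise from `x⁻¹ ∈ U_{(1,2)}`). [cite: Zelevinsky1980, §1.1] -/
theorem gkAutomorphism_mem_unipotentRadical_two_one {x : GL (Fin 3) F} (hx : x ∈ unipotentRadicalGL F (![0, 1, 1] : Fin 3 → Fin 2)) :
    gkAutomorphism x ∈ unipotentRadicalGL F (![0, 0, 1] : Fin 3 → Fin 2) := by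
  have hrel : ∀ i j : Fin 3, (![0, 0, 1] : Fin 3 → Fin 2) j < ![0, 0, 1] i → (![0, 1, 1] : Fin 3 → Fin 2) i.rev < ![0, 1, 1] j.rev := by decide
  have heq : ∀ i j : Fin 3, (![0, 0, 1] : Fin 3 → Fin 2) i = ![0, 0, 1] j → (![0, 1, 1] : Fin 3 → Fin 2) j.rev = ![0, 1, 1] i.rev := by decide
  have hy := (unipotentRadicalGL F (![0, 1, 1] : Fin 3 → Fin 2)).inv_mem hx
  refine mem_unipotentRadicalGL_of_apply _ (fun i j hij => ?_) (fun i j hij => ?_)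
  · rw [coe_gkAutomorphism_apply]
    exact (unipotentRadicalGL_le F _ hy) (hrel i j hij)
  · rw [coe_gkAutomorphism_apply, apply_eq_of_mem_unipotentRadicalGL _ hy j.rev i.rev (heq i j hij)]
    by_cases hij' : i = j
    · subst hij'; rw [if_pos rfl, if_pos rfl]
    · rw [if_neg hij', if_neg fun h' => hij' (Fin.rev_injective h').symm]

/-- **`θ(U_{(2,1)}) ⊆ U_{(1,2)}`**. [cite: Zelevinsky1980, §1.1] -/
theorem gkAutomorphism_mem_unipotentRadical_one_two {x : GL (Fin 3) F} (hx : x ∈ unipotentRadicalGL F (![0, 0, 1] : Fin 3 → Fin 2)) :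
    gkAutomorphism x ∈ unipotentRadicalGL F (![0, 1, 1] : Fin 3 → Fin 2) := by
  have hrel : ∀ i j : Fin 3, (![0, 1, 1] : Fin 3 → Fin 2) j < ![0, 1, 1] i → (![0, 0, 1] : Fin 3 → Fin 2) i.rev < ![0, 0, 1] j.rev := by decide
  have heq : ∀ i j : Fin 3, (![0, 1, 1] : Fin 3 → Fin 2) i = ![0, 1, 1] j → (![0, 0, 1] : Fin 3 → Fin 2) j.rev = ![0, 0, 1] i.rev := by decide
  have hy := (unipotentRadicalGL F (![0, 0, 1] : Fin 3 → Fin 2)).inv_mem hx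
  refine mem_unipotentRadicalGL_of_apply _ (fun i j hij => ?_) (fun i j hij => ?_)
  · rw [coe_gkAutomorphism_apply]
    exact (unipotentRadicalGL_le F _ hy) (hrel i j hij)
  · rw [coe_gkAutomorphism_apply, apply_eq_of_mem_unipotentRadicalGL _ hy j.rev i.rev (heq i j hij)]
    by_cases hij' : i = j
    · subst hij'; rw [if_pos rfl, if_pos rfl]
    · rw [if_neg hij', if_neg fun h' => hij' (Fin.rev_injective h').symm]

omit [ValuativeRel F] [TopologicalSpace F] [IsNonarchimedeanLocalField F] in
/-- From `U` as a subgroup of `GL_n` to the kernel of the Levi projection inside `P`. [cite: BernsteinZelevinskyASENS1977, §2.1] -/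
theorem mem_unipotentRadicalP_iff {m : ℕ} {α : Type*} [LinearOrder α] (c : Fin m → α) (p : ↥(standardParabolicGL F c)) :
    p ∈ unipotentRadicalP F c ↔ (p : GL (Fin m) F) ∈ unipotentRadicalGL F c := by
  rw [← unipotentRadicalGL_subgroupOf, Subgroup.mem_subgroupOf]

/-- **T1 (HEAD).**  If `i_{![0,0,1]} σ'` (`Q = P_{(2,1)}`) is irreducible for EVERY irreducible smooth supercuspidal representation `σ'` of the Levi `GL₂(F) × GL₁(F)` on `W`,
then `i_{![0,1,1]} σ` (`Q' = P_{(1,2)}`) is irreducible for every irreducible smooth supercuspidal `σ` of `GL₁(F) × GL₂(F)` on `W` — §2 for the involution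
`θ(g) = w₀ ᵗg⁻¹ w₀` (★ `gkAutomorphism`), which exchanges the two parabolics and their unipotent radicals. [cite: Zelevinsky1980, §1.1, Thm. 4.2]
[cite: BernsteinZelevinskyASENS1977, §2.3] -/
theorem isIrreducible_parabolicIndGL_one_two_of_two_one {W : Type*} [AddCommGroup W] [Module ℂ W]
    (h : ∀ σ' : Representation ℂ (Π b, GL {i // (![0, 0, 1] : Fin 3 → Fin 2) i = b} F) W,
      σ'.IsIrreducible → σ'.IsSmooth → σ'.IsSupercuspidal → (parabolicIndGL F (![0, 0, 1] : Fin 3 → Fin 2) σ').IsIrreducible)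
    (σ : Representation ℂ (Π a, GL {i // (![0, 1, 1] : Fin 3 → Fin 2) i = a} F) W) [σ.IsIrreducible] (hσ : σ.IsSmooth) (hsc : σ.IsSupercuspidal) :
    (parabolicIndGL F (![0, 1, 1] : Fin 3 → Fin 2) σ).IsIrreducible :=
  isIrreducible_parabolicIndGL_of_involution F (![0, 1, 1] : Fin 3 → Fin 2) (![0, 0, 1] : Fin 3 → Fin 2) gkAutomorphism
    (gkAutomorphism_gkAutomorphism F) (gkAutomorphism_mem_parabolic_two_one_iff F) (gkAutomorphism_mem_parabolic_one_two_iff F)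
    (fun _ hp => (mem_unipotentRadicalP_iff F _ _).2 (gkAutomorphism_mem_unipotentRadical_two_one F ((mem_unipotentRadicalP_iff F _ _).1 hp)))
    (fun _ hp => (mem_unipotentRadicalP_iff F _ _).2 (gkAutomorphism_mem_unipotentRadical_one_two F ((mem_unipotentRadicalP_iff F _ _).1 hp)))
    h σ hσ hsc

/-- **T1 (HEAD, the other direction).**  If `i_{![0,1,1]} σ'` is irreducible for every irreducible smooth supercuspidal `σ'` of `GL₁(F) × GL₂(F)` on `W`, then
`i_{![0,0,1]} σ` is irreducible for every irreducible smooth supercuspidal `σ` of `GL₂(F) × GL₁(F)` on `W`. [cite: Zelevinsky1980, §1.1, Thm. 4.2] -/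
theorem isIrreducible_parabolicIndGL_two_one_of_one_two {W : Type*} [AddCommGroup W] [Module ℂ W]
    (h : ∀ σ' : Representation ℂ (Π b, GL {i // (![0, 1, 1] : Fin 3 → Fin 2) i = b} F) W,
      σ'.IsIrreducible → σ'.IsSmooth → σ'.IsSupercuspidal → (parabolicIndGL F (![0, 1, 1] : Fin 3 → Fin 2) σ').IsIrreducible)
    (σ : Representation ℂ (Π a, GL {i // (![0, 0, 1] : Fin 3 → Fin 2) i = a} F) W) [σ.IsIrreducible] (hσ : σ.IsSmooth) (hsc : σ.IsSupercuspidal) :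
    (parabolicIndGL F (![0, 0, 1] : Fin 3 → Fin 2) σ).IsIrreducible :=
  isIrreducible_parabolicIndGL_of_involution F (![0, 0, 1] : Fin 3 → Fin 2) (![0, 1, 1] : Fin 3 → Fin 2) gkAutomorphism
    (gkAutomorphism_gkAutomorphism F) (gkAutomorphism_mem_parabolic_one_two_iff F) (gkAutomorphism_mem_parabolic_two_one_iff F)
    (fun _ hp => (mem_unipotentRadicalP_iff F _ _).2 (gkAutomorphism_mem_unipotentRadical_one_two F ((mem_unipotentRadicalP_iff F _ _).1 hp)))
    (fun _ hp => (mem_unipotentRadicalP_iff F _ _).2 (gkAutomorphism_mem_unipotentRadical_two_one F ((mem_unipotentRadicalP_iff F _ _).1 hp)))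
    h σ hσ hsc

end GL3

end Summit.HodgeConjecture.HodgeConjecture.Cruxes.H413.K2E3GL3OuterAutomorphismInduction

end
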